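/-
Copyright (c) 2026. All rights reserved.
Released under Apache 2.0 license as described in the file LICENSE.
Authors: abc-iut cell, WAVE-5 prover seat abc-iut-w5-d044 (gen 3).
-/
import Literature.GroupTheory.NikolovSegal
import Literature.IUT.HodgeTheaters.CoveringsErrata
import HarnessLib

/-!
# The two tree statements of Nikolov–Segal [NS, Thm 1.1] are one assumption (kernel bridge)

N. Nikolov, D. Segal, *Finite index subgroups in profinite groups*, C. R. Math. Acad. Sci. Paris **337**
(2003) 303–308, Thm 1.1: "in a topologically finitely generated profinite group every subgroup of finite
index is open".  The tree carries this theorem as a NAMED FACT twice: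

* `Literature.IUT.HodgeTheaters.Rmk253.FiniteIndexOpenOfTopFG` (`CoveringsErrata.lean`, the input quoted
  by [IUTchI] Rmk 2.5.3 (vi) (O3) p. 56; frozen FACT-LIST row F-1977, admissible), stated over Mathlib's
  bundled `ProfiniteGrp` and the tree's `AbsoluteAnabelian.IsTopologicallyFinitelyGenerated`
  ("some finite subset generates a subgroup whose topological closure is `⊤`");
* `Literature.GroupTheory.NikolovSegalStatement` (`NikolovSegal.lean`, consumer: the [SemiAnbd] §5
  congruence-continuity of the arithmetic outer action), stated over an unbundled compact totally
  disconnected topological group with a finite subset generating a DENSE subgroup.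

This PROOF-ONLY file shows the two `Prop`s are EQUIVALENT in the kernel
(`nikolovSegalStatement_iff_finiteIndexOpenOfTopFG`), so that a consumer of either binds the same single
published prerequisite (D-0026 debt accounting: one assumption, not two).  Nothing here proves
Nikolov–Segal; no new definition, no new named fact.
-/

namespace Literature.IUT.HodgeTheaters

namespace Rmk253

universe u

open Literature.AnabelianGeometry.AbsoluteAnabelian in
/-- For a topological group, "some finite subset generates a dense subgroup" (the hypothesis of
`Literature.GroupTheory.NikolovSegalStatement`) is the tree's
`AbsoluteAnabelian.IsTopologicallyFinitelyGenerated` ([AbsTopI] §0: the generated subgroup has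
topological closure `⊤`). [cite: MochizukiAbsTopI2012, §0 p.8] -/
theorem isTopologicallyFinitelyGenerated_iff_exists_finset_dense (G : Type u) [Group G]
    [TopologicalSpace G] [IsTopologicalGroup G] :
    IsTopologicallyFinitelyGenerated G ↔
      ∃ S : Finset G, Dense ((Subgroup.closure (S : Set G) : Subgroup G) : Set G) := by
  rw [isTopologicallyFinitelyGenerated_iff]
  refine exists_congr fun S => ?_
  rw [dense_iff_closure_eq, ← Subgroup.topologicalClosure_coe, ← Subgroup.coe_top (G := G),
    SetLike.coe_set_eq]

/-- **Kernel bridge between the two tree statements of [NS] Thm 1.1**: the unbundled form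
`Literature.GroupTheory.NikolovSegalStatement` (compact, totally disconnected topological group with a
finite subset generating a dense subgroup ⇒ finite-index subgroups are open) is EQUIVALENT to the
`ProfiniteGrp` form `Rmk253.FiniteIndexOpenOfTopFG` quoted by [IUTchI] Rmk 2.5.3 (vi) (O3) (frozen
FACT-LIST row F-1977).  (`ProfiniteGrp.of` supplies the Hausdorff property from total disconnectedness.)
[cite: NikolovSegal2003, Thm 1.1] [cite: Mochizuki2012, IUTchI Rmk 2.5.3 (vi) (O3) p.56] -/
theorem nikolovSegalStatement_iff_finiteIndexOpenOfTopFG :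
    Literature.GroupTheory.NikolovSegalStatement.{u} ↔ FiniteIndexOpenOfTopFG.{u} := by
  constructor
  · intro hNS H hTFG U hU
    obtain ⟨S, hS⟩ := (isTopologicallyFinitelyGenerated_iff_exists_finset_dense H).mp hTFG
    exact hNS H ⟨S, hS⟩ U hU
  · intro h M _ _ _ _ _ hM U hU
    have hTFG : Literature.AnabelianGeometry.AbsoluteAnabelian.IsTopologicallyFinitelyGenerated
        (ProfiniteGrp.of M) :=
      (isTopologicallyFinitelyGenerated_iff_exists_finset_dense M).mpr hM
    exact h (ProfiniteGrp.of M) hTFG U hU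

/-- `NikolovSegalStatement` ⇒ the [IUTchI] Rmk 2.5.3 (vi) (O3) input `FiniteIndexOpenOfTopFG`
(one direction of the bridge, for consumers holding the unbundled form).
[cite: NikolovSegal2003, Thm 1.1] -/
theorem finiteIndexOpenOfTopFG_of_nikolovSegalStatement
    (h : Literature.GroupTheory.NikolovSegalStatement.{u}) : FiniteIndexOpenOfTopFG.{u} :=
  nikolovSegalStatement_iff_finiteIndexOpenOfTopFG.mp h

/-- The [IUTchI] Rmk 2.5.3 (vi) (O3) input `FiniteIndexOpenOfTopFG` (frozen FACT-LIST row F-1977) ⇒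
`NikolovSegalStatement` (the other direction, for consumers holding the bundled form).
[cite: NikolovSegal2003, Thm 1.1] -/
theorem nikolovSegalStatement_of_finiteIndexOpenOfTopFG (h : FiniteIndexOpenOfTopFG.{u}) :
    Literature.GroupTheory.NikolovSegalStatement.{u} :=
  nikolovSegalStatement_iff_finiteIndexOpenOfTopFG.mpr h

end Rmk253

end Literature.IUT.HodgeTheaters
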